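/-
Copyright (c) 2026.  Released under the Apache 2.0 license of this project.
Cell decomp-a2c, lens 4 (minimal-counterexample / extremal reduction), generation 69 — the far-field JET model;
revised in generation 70 (critic row 1246, objection U1: the jet majorisation is asked on the ANNULUS only).
-/
import Summits.AtomisticToContinuum.Crystallization.Theorems.OverbindingBudgetAffineRadialChartFit

/-!
(SPLIT FOR THE 400-LINE CAP by the landing lane, hand-2 g33: this file = part 1 of 3; sequels `…OverbindingBudgetAffineRadialJetB`, `…OverbindingBudgetAffineRadialJet` import it in a chain; same namespace, all FQNs unchanged.)
# The far-field jet: `ψ = (S₆ + J₆)/(S₃ + J₃)²` with POLYNOMIAL far fields, its radial reduction, and the radius-split glue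

Generations 67/68 model the two window sums of leaf Z2 on the pinned Gram chart `E5` by a finite inverse-power
family plus CONSTANT far fields (`…RadialReduction.FamilyData`: `P = S₃ + F₃`, `N = S₆ + F₆`).  Generation 69
(lens 4, extremal reduction AT THE CENTRE) measured that a constant far field cannot carry the certificate near the
class centre `x₀`: for the 954-member family of the line of record (`|v| ≤ 5.5`) the six-sum far field at the hcp
point has value `0.03664`, chart GRADIENT of norm `0.0882` and Hessian `≼ 0.44` (mirror `num/farjet.py`), while the
slack of `ψ = N/P²` above `b` is only `≈ 0.04·‖x − x₀‖²`; a far-field constant valid on a cell of half-width `h`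
centred at distance `r` therefore needs `h ≲ 28·α·r²` (`α` = its share of the slack), i.e. `h ≤ 5.7 r²` at
`α = 0.2` — sixty times finer than the `340 r²` budgeted in generation 67, and fatal for ONE constant over the whole
region (the sibling line of generation 68: deficit `δ₀ ≈ 3·10⁻⁴ ≫ ½ m₀ r₁²`).

THE REPAIR typed here: the far fields become explicit POLYNOMIAL JETS centred at `x₀`,
`J(y) = F + g(y − x₀) + H(y − x₀, y − x₀) + κ·e(y − x₀, y − x₀)²` (value, linear, bilinear, and a quartic
`κ‖y − x₀‖⁴` when `e` is the inner product — the smooth carrier of the third-order Taylor remainder via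
`‖δ‖³ ≤ (ε/2)‖δ‖² + ‖δ‖⁴/(2ε)`).  One GLOBAL jet per window class suffices on the whole chart region (third-derivative
constant of the far field `≤ 60·Λ³·T_far ≈ 26`, `Λ ≤ 2.28` the pencil constant of the chart at `x = 0`), and its
certification needs the far-field value to `4·10⁻⁵`, the gradient to `8 %` and the Hessian to `O(1)` only (memo
NODE-g69 §3).  Everything downstream of the model is re-proved for the jet model with the SAME conclusions:

* §1 one-variable calculus (`hasDerivAt_poly4`) and the per-term algebraic Taylor inequality of the cube
  (`inv_pow_three_eq_jet_add_rem`, `inv_pow_three_le_jet_of_nonneg`, `inv_pow_three_le_jet`: `(c₀+L)⁻³ ≤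
  c₀⁻³ − 3c₀⁻⁴L + 6c₀⁻⁵L² + 10|L|³/(c₀³(c₀+L)³)`, the seed of the UPPER jet enclosure of the cube window sum);
* §2 `JetData`, `JetData.eval/d1/d2`, the line expansions `eval_line`/`d1_line` (exact quartic polynomials in `t`) and
  `hasDerivAt_eval_line`/`hasDerivAt_d1_line`; the constant jet `JetData.const` (the generation-68 model is the case
  `g = H = e = 0`: `PJ_const`, `NJ_const`);
* §3 the jet model `PJ = S₃ + J₃`, `NJ = S₆ + J₆`, `psiJ = NJ/PJ²` with CLOSED-FORM radial slope/curvature fields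
  `psiJ₁`/`psiJ₂` (the row format of the derivative tables), `hasDerivAt_psiJ_line`, `hasDerivAt_psiJ₁_line`, and
  ★ `radial_reductionJ` / ★ `radial_reduction_collarJ` (`…RadialReduction(A).radial_reduction(_collar)` instantiated);
* §4 the Gram-chart glue WITH A RADIUS SPLIT and NO (far) obligation: `ratio_of_chartTables` (scale-free algebra at a
  chart point), `table_of_split` (inner ball `‖gramChart X − x₀‖ < r₁` by ANY table — the zone-I/II device of the line of
  record — and the outer region by the jet tables), `inner_of_far` (the old (far) route is the special case «inner table
  vacuous»), ★★ `outerTable_of_radialTablesJ`, `outerTable_of_collarTablesJ`, `outerTable_of_valueTableJ`, and ★★★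
  `farCoreExcess_of_splitJetTables` : Z2 `FarCoreExcess (1/25) (1/2000) (1/(2·10⁷))` from, per window, an inner table on
  `B(x₀ w, r₁ w)`, the two jet enclosures (upper-J) `chartScale X⁶·T₃↑ ≤ PJ (gramChart X)` / (lower-J)
  `NJ (gramChart X) ≤ chartScale X¹²·T₆↓` OUTSIDE that ball, the radial tables (C)/(B)/(G),(0) of `psiJ`, the side
  conditions and the hcp enclosures (`…RadialGlue.farCoreExcess_of_ratioTables`).
No `sorry`, no new axioms; nothing of the slot is restated.
-/

noncomputable section

open Set

namespace Summit.AtomisticToContinuum.Crystallization.Theorems.OverbindingBudgetAffineRadialJet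

open Literature.MathematicalPhysics.StatisticalMechanics
open Summit.AtomisticToContinuum.Crystallization.Theorems.OverbindingBudgetAffineFarSmoothSplit
open Summit.AtomisticToContinuum.Crystallization.Theorems.OverbindingBudgetAffineRadialReduction
open Summit.AtomisticToContinuum.Crystallization.Theorems.OverbindingBudgetAffineRadialGlue
open Summit.AtomisticToContinuum.Crystallization.Theorems.OverbindingBudgetAffineRadialChart

local notation "E3" => EuclideanSpace ℝ (Fin 3)
local notation "E5" => EuclideanSpace ℝ (Fin 5)

/-! ## §1 One-variable calculus and the per-term Taylor inequality of the cube -/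

/-- The derivative at `0` of a real quartic `c₀ + c₁t + c₂t² + c₃t³ + c₄t⁴` is `c₁`. [formal bookkeeping] -/
private theorem hasDerivAt_poly4 (c₀ c₁ c₂ c₃ c₄ : ℝ) :
    HasDerivAt (fun t : ℝ => c₀ + c₁ * t + c₂ * t ^ 2 + c₃ * t ^ 3 + c₄ * t ^ 4) c₁ 0 := by
  have h1 := (hasDerivAt_id' (0 : ℝ)).const_mul c₁
  have h2 := (hasDerivAt_pow 2 (0 : ℝ)).const_mul c₂
  have h3 := (hasDerivAt_pow 3 (0 : ℝ)).const_mul c₃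
  have h4 := (hasDerivAt_pow 4 (0 : ℝ)).const_mul c₄
  have h := (((h1.const_add c₀).add h2).add h3).add h4
  refine h.congr_deriv ?_
  norm_num

/-- Exact second-order Taylor expansion of the cube with algebraic remainder:
`(c₀+L)⁻³ = c₀⁻³ − 3c₀⁻⁴L + 6c₀⁻⁵L² − L³(10c₀² + 15c₀L + 6L²)/(c₀⁵(c₀+L)³)`. [this file] -/
theorem inv_pow_three_eq_jet_add_rem {c₀ L : ℝ} (hc₀ : c₀ ≠ 0) (hc : c₀ + L ≠ 0) :
    ((c₀ + L) ^ 3)⁻¹ = (c₀ ^ 3)⁻¹ - 3 * L * (c₀ ^ 4)⁻¹ + 6 * L ^ 2 * (c₀ ^ 5)⁻¹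
      - L ^ 3 * (10 * c₀ ^ 2 + 15 * c₀ * L + 6 * L ^ 2) * (c₀ ^ 5 * (c₀ + L) ^ 3)⁻¹ := by
  field_simp
  ring

/-- For a NON-NEGATIVE increment the second-order jet of the cube is already a majorant (the third derivative of
`c ↦ c⁻³` is negative): `(c₀+L)⁻³ ≤ c₀⁻³ − 3c₀⁻⁴L + 6c₀⁻⁵L²` (`c₀ > 0`, `L ≥ 0`). [this file] -/
theorem inv_pow_three_le_jet_of_nonneg {c₀ L : ℝ} (hc₀ : 0 < c₀) (hL : 0 ≤ L) :
    ((c₀ + L) ^ 3)⁻¹ ≤ (c₀ ^ 3)⁻¹ - 3 * L * (c₀ ^ 4)⁻¹ + 6 * L ^ 2 * (c₀ ^ 5)⁻¹ := by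
  have hc : 0 < c₀ + L := by linarith
  rw [inv_pow_three_eq_jet_add_rem hc₀.ne' hc.ne']
  have hR : 0 ≤ L ^ 3 * (10 * c₀ ^ 2 + 15 * c₀ * L + 6 * L ^ 2) * (c₀ ^ 5 * (c₀ + L) ^ 3)⁻¹ := by positivity
  linarith

/-- ★ The per-term UPPER Taylor inequality of the cube for an increment of either sign:
`(c₀+L)⁻³ ≤ c₀⁻³ − 3c₀⁻⁴L + 6c₀⁻⁵L² + 10|L|³/(c₀³(c₀+L)³)` (`c₀ > 0`, `c₀ + L > 0`).  Summed over the far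
lattice vectors (`c₀ = c_v(x₀)`, `L = L_v(x − x₀)`) this is the jet enclosure (upper-J) of the cube window sum, with a
third-order remainder controlled by `|L_v(δ)| ≤ Λ‖δ‖c_v`. [this file] -/
theorem inv_pow_three_le_jet {c₀ L : ℝ} (hc₀ : 0 < c₀) (hc : 0 < c₀ + L) :
    ((c₀ + L) ^ 3)⁻¹ ≤ (c₀ ^ 3)⁻¹ - 3 * L * (c₀ ^ 4)⁻¹ + 6 * L ^ 2 * (c₀ ^ 5)⁻¹
      + 10 * |L| ^ 3 * (c₀ ^ 3 * (c₀ + L) ^ 3)⁻¹ := by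
  rcases le_or_gt 0 L with hL | hL
  · have h := inv_pow_three_le_jet_of_nonneg hc₀ hL
    have hR : 0 ≤ 10 * |L| ^ 3 * (c₀ ^ 3 * (c₀ + L) ^ 3)⁻¹ := by positivity
    linarith
  · rw [inv_pow_three_eq_jet_add_rem hc₀.ne' hc.ne', abs_of_neg hL]
    -- remainder: −L³(10c₀² + 15c₀L + 6L²)/(c₀⁵c³) ≤ 10(−L)³/(c₀³c³)  ⟸  10c₀² + 15c₀L + 6L² ≤ 10c₀² (−c₀ < L < 0)
    have hc3 : 0 < (c₀ + L) ^ 3 := pow_pos hc 3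
    have hc₀5 : 0 < c₀ ^ 5 := pow_pos hc₀ 5
    have hkey : -L ^ 3 * (10 * c₀ ^ 2 + 15 * c₀ * L + 6 * L ^ 2) ≤ c₀ ^ 2 * (10 * (-L) ^ 3) := by
      have h1 : 0 ≤ -L := by linarith
      have h2 : 15 * c₀ * L + 6 * L ^ 2 ≤ 0 := by nlinarith
      nlinarith [pow_nonneg h1 3]
    have e1 : -(L ^ 3 * (10 * c₀ ^ 2 + 15 * c₀ * L + 6 * L ^ 2) * (c₀ ^ 5 * (c₀ + L) ^ 3)⁻¹)
        = (-L ^ 3 * (10 * c₀ ^ 2 + 15 * c₀ * L + 6 * L ^ 2)) / (c₀ ^ 5 * (c₀ + L) ^ 3) := by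
      rw [div_eq_mul_inv]; ring
    have e2 : 10 * (-L) ^ 3 * (c₀ ^ 3 * (c₀ + L) ^ 3)⁻¹ = (c₀ ^ 2 * (10 * (-L) ^ 3)) / (c₀ ^ 5 * (c₀ + L) ^ 3) := by
      field_simp
    have hle : (-L ^ 3 * (10 * c₀ ^ 2 + 15 * c₀ * L + 6 * L ^ 2)) / (c₀ ^ 5 * (c₀ + L) ^ 3)
        ≤ (c₀ ^ 2 * (10 * (-L) ^ 3)) / (c₀ ^ 5 * (c₀ + L) ^ 3) :=
      div_le_div_of_nonneg_right hkey (by positivity)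
    rw [sub_eq_add_neg, e1, e2]
    linarith

/-- ★★ **The SUMMED jet inequality (the in-plane far REST majorised by value + gradient + inflated Hessian sums).**
For any index type: if `c₀ t > 0`, `c₀ t + L t > 0`, `c₀ t ≤ μ·(c₀ t + L t)` (anisotropy), `|L t| ≤ λ·r·c₀ t` (pencil
bound at displacement norm `r`, `λr ≥ 0`), and the three coefficient families have sums `F = Σ c₀⁻³`, `G = Σ L·c₀⁻⁴`,
`H = Σ L²·c₀⁻⁵`, then `Σ' (c₀ t + L t)⁻³ ≤ F − 3G + (6 + 10μ³λr)·H` (and the left family is summable).  With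
`c₀ t = c_t(x₀)`, `L t = L_t(y − x₀)` this is the jet enclosure of a layer rest / of the whole far field: `G`, `H` are linear /
quadratic in `y − x₀` with lattice-sum coefficients (memo §3, J1), and NO cubic or quartic carrier is needed on a jet zone
`‖y − x₀‖ ≤ ρ_J` (`r ≤ ρ_J`; the inflation `10μ³λρ_J·H` is the whole third-order price). [this file] -/
theorem tsum_inv_cube_le_jet {α : Type*} {c₀ L : α → ℝ} {μ lam r F G H : ℝ}
    (hc₀ : ∀ t, 0 < c₀ t) (hc : ∀ t, 0 < c₀ t + L t) (hμ : ∀ t, c₀ t ≤ μ * (c₀ t + L t))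
    (hlam : ∀ t, |L t| ≤ lam * r * c₀ t) (hlr : 0 ≤ lam * r)
    (hF : HasSum (fun t => (c₀ t ^ 3)⁻¹) F) (hG : HasSum (fun t => L t * (c₀ t ^ 4)⁻¹) G)
    (hH : HasSum (fun t => L t ^ 2 * (c₀ t ^ 5)⁻¹) H) :
    Summable (fun t => ((c₀ t + L t) ^ 3)⁻¹) ∧
      ∑' t, ((c₀ t + L t) ^ 3)⁻¹ ≤ F - 3 * G + (6 + 10 * μ ^ 3 * (lam * r)) * H := by
  -- the dominating family and its sum
  set g : α → ℝ := fun t => (c₀ t ^ 3)⁻¹ - 3 * (L t * (c₀ t ^ 4)⁻¹)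
    + (6 + 10 * μ ^ 3 * (lam * r)) * (L t ^ 2 * (c₀ t ^ 5)⁻¹) with hg
  have hgs : HasSum g (F - 3 * G + (6 + 10 * μ ^ 3 * (lam * r)) * H) :=
    (hF.sub (hG.mul_left 3)).add (hH.mul_left _)
  -- the inverse-cube bound `c⁻³ ≤ μ³ c₀⁻³`
  have hdom : ∀ t, ((c₀ t + L t) ^ 3)⁻¹ ≤ μ ^ 3 * (c₀ t ^ 3)⁻¹ := by
    intro t
    have h1 : c₀ t ^ 3 ≤ (μ * (c₀ t + L t)) ^ 3 := pow_le_pow_left₀ (hc₀ t).le (hμ t) 3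
    rw [mul_pow] at h1
    rw [← one_div, ← div_eq_mul_inv, div_le_div_iff₀ (pow_pos (hc t) 3) (pow_pos (hc₀ t) 3), one_mul]
    exact h1
  -- termwise: the per-term jet inequality with the cubic remainder folded into the Hessian term
  have hle : ∀ t, ((c₀ t + L t) ^ 3)⁻¹ ≤ g t := by
    intro t
    have h := inv_pow_three_le_jet (hc₀ t) (hc t)
    have habs3 : |L t| ^ 3 = |L t| * L t ^ 2 := by
      rw [pow_succ', sq_abs]
    have hkey : 10 * |L t| ^ 3 * (c₀ t ^ 3 * (c₀ t + L t) ^ 3)⁻¹ ≤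
        10 * μ ^ 3 * (lam * r) * (L t ^ 2 * (c₀ t ^ 5)⁻¹) := by
      have hc3 : 0 < c₀ t ^ 3 * (c₀ t + L t) ^ 3 := by
        have := hc₀ t; have := hc t; positivity
      have hc5 : 0 < c₀ t ^ 5 := pow_pos (hc₀ t) 5
      rw [show 10 * μ ^ 3 * (lam * r) * (L t ^ 2 * (c₀ t ^ 5)⁻¹) = (10 * μ ^ 3 * (lam * r) * L t ^ 2) / c₀ t ^ 5 by
        rw [div_eq_mul_inv]; ring, ← div_eq_mul_inv, div_le_div_iff₀ hc3 hc5]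
      have hc₀' := (hc₀ t).le
      have hcn := (hc t).le
      calc 10 * |L t| ^ 3 * c₀ t ^ 5 = 10 * (|L t| * L t ^ 2) * c₀ t ^ 5 := by rw [habs3]
        _ ≤ 10 * (lam * r * c₀ t * L t ^ 2) * c₀ t ^ 5 := by gcongr; exact hlam t
        _ = 10 * (lam * r) * L t ^ 2 * c₀ t ^ 3 * c₀ t ^ 3 := by ring
        _ ≤ 10 * (lam * r) * L t ^ 2 * c₀ t ^ 3 * (μ * (c₀ t + L t)) ^ 3 := by gcongr; exact hμ t
        _ = 10 * μ ^ 3 * (lam * r) * L t ^ 2 * (c₀ t ^ 3 * (c₀ t + L t) ^ 3) := by ring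
    simp only [hg]
    linarith
  -- summability by domination, then comparison of sums
  have hnn : ∀ t, 0 ≤ ((c₀ t + L t) ^ 3)⁻¹ := fun t => by have := hc t; positivity
  have hfs : Summable fun t => ((c₀ t + L t) ^ 3)⁻¹ :=
    Summable.of_nonneg_of_le hnn hdom (hF.summable.mul_left _)
  exact ⟨hfs, hasSum_le hle hfs.hasSum hgs⟩

/-! ## §2 Polynomial jets on the chart space -/

section Jet

variable {E : Type*} [AddCommGroup E] [Module ℝ E]

/-- A POLYNOMIAL FAR-FIELD JET on the chart space, centred at `x₀`: value `F`, linear part `g`, a bilinear part `H`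
(the second-order Taylor coefficient — not halved) and a quartic `κ·e(δ,δ)²` for a second bilinear form `e` (the inner
product in the intended instance, so that the quartic is `κ‖δ‖⁴`, the smooth carrier of the third-order remainder).
`J(y) = F + g(y − x₀) + H(y − x₀)(y − x₀) + κ·(e(y − x₀)(y − x₀))²`. -/
structure JetData (E : Type*) [AddCommGroup E] [Module ℝ E] where
  /-- centre of the jet -/
  x₀ : E
  /-- value at the centre -/
  F : ℝ
  /-- linear part -/
  g : E →ₗ[ℝ] ℝ
  /-- bilinear (second-order) part -/
  H : E →ₗ[ℝ] E →ₗ[ℝ] ℝ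
  /-- bilinear form of the quartic remainder carrier -/
  e : E →ₗ[ℝ] E →ₗ[ℝ] ℝ
  /-- coefficient of the quartic `(e δ δ)²` -/
  κ : ℝ

namespace JetData

variable (J : JetData E)

/-- The jet as a function on the chart space. -/
def eval (y : E) : ℝ :=
  J.F + J.g (y - J.x₀) + J.H (y - J.x₀) (y - J.x₀) + J.κ * (J.e (y - J.x₀) (y - J.x₀)) ^ 2

/-- First line derivative of the jet at `y` in direction `u` (closed form). -/
def d1 (y u : E) : ℝ :=
  J.g u + (J.H (y - J.x₀) u + J.H u (y - J.x₀))
    + J.κ * (2 * J.e (y - J.x₀) (y - J.x₀) * (J.e (y - J.x₀) u + J.e u (y - J.x₀)))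

/-- Second line derivative of the jet at `y` in direction `u` (closed form). -/
def d2 (y u : E) : ℝ :=
  2 * J.H u u
    + J.κ * (2 * (J.e (y - J.x₀) u + J.e u (y - J.x₀)) ^ 2 + 4 * J.e (y - J.x₀) (y - J.x₀) * J.e u u)

/-- Along the line `y + t u` the jet is an explicit quartic polynomial in `t` whose linear coefficient is `d1`.
[formal bookkeeping] -/
theorem eval_line (y u : E) (t : ℝ) :
    J.eval (y + t • u) =
      (J.F + J.g (y - J.x₀) + J.H (y - J.x₀) (y - J.x₀) + J.κ * (J.e (y - J.x₀) (y - J.x₀)) ^ 2)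
      + J.d1 y u * t
      + (J.H u u + J.κ * ((J.e (y - J.x₀) u + J.e u (y - J.x₀)) ^ 2
          + 2 * J.e (y - J.x₀) (y - J.x₀) * J.e u u)) * t ^ 2
      + (2 * J.κ * (J.e (y - J.x₀) u + J.e u (y - J.x₀)) * J.e u u) * t ^ 3
      + (J.κ * (J.e u u) ^ 2) * t ^ 4 := by
  have hδ : y + t • u - J.x₀ = (y - J.x₀) + t • u := by abel
  unfold eval d1
  rw [hδ]
  simp only [map_add, map_smul, LinearMap.add_apply, LinearMap.smul_apply, smul_eq_mul]
  ring

/-- Along the line `y + t u` the slope field `d1 (y + t u) u` is an explicit cubic in `t` whose linear coefficient is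
`d2`. [formal bookkeeping] -/
theorem d1_line (y u : E) (t : ℝ) :
    J.d1 (y + t • u) u =
      J.d1 y u + J.d2 y u * t
      + (6 * J.κ * (J.e (y - J.x₀) u + J.e u (y - J.x₀)) * J.e u u) * t ^ 2
      + (4 * J.κ * (J.e u u) ^ 2) * t ^ 3 + 0 * t ^ 4 := by
  have hδ : y + t • u - J.x₀ = (y - J.x₀) + t • u := by abel
  unfold d1 d2
  rw [hδ]
  simp only [map_add, map_smul, LinearMap.add_apply, LinearMap.smul_apply, smul_eq_mul]
  ring

/-- `t ↦ J(y + t u)` has derivative `d1 y u` at `0`. [this file] -/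
theorem hasDerivAt_eval_line (y u : E) : HasDerivAt (fun t : ℝ => J.eval (y + t • u)) (J.d1 y u) 0 := by
  have hfun := funext fun t : ℝ => J.eval_line y u t
  rw [hfun]
  exact hasDerivAt_poly4 _ _ _ _ _

/-- `t ↦ d1 (y + t u) u` has derivative `d2 y u` at `0`. [this file] -/
theorem hasDerivAt_d1_line (y u : E) : HasDerivAt (fun t : ℝ => J.d1 (y + t • u) u) (J.d2 y u) 0 := by
  have hfun := funext fun t : ℝ => J.d1_line y u t
  rw [hfun]
  exact hasDerivAt_poly4 _ _ _ _ _

/-- The CONSTANT jet (the far-field model of generations 67/68). -/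
def const (x₀ : E) (F : ℝ) : JetData E := ⟨x₀, F, 0, 0, 0, 0⟩

/-- `eval_const` (docstring added by the landing lane; see the module docstring). [formal bookkeeping] -/
@[simp] theorem eval_const (x₀ : E) (F : ℝ) (y : E) : (const x₀ F).eval y = F := by
  simp [const, eval]

/-- `d1_const` (docstring added by the landing lane; see the module docstring). [formal bookkeeping] -/
@[simp] theorem d1_const (x₀ : E) (F : ℝ) (y u : E) : (const x₀ F).d1 y u = 0 := by
  simp [const, d1]

/-- `d2_const` (docstring added by the landing lane; see the module docstring). [formal bookkeeping] -/
@[simp] theorem d2_const (x₀ : E) (F : ℝ) (y u : E) : (const x₀ F).d2 y u = 0 := by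
  simp [const, d2]

end JetData

end Jet

/-! ## §3 The jet model `ψ = (S₆ + J₆)/(S₃ + J₃)²` and its radial reduction -/

section Model

variable {E : Type*} [AddCommGroup E] [Module ℝ E] {ι : Type*} (D : FamilyData E ι) (J₃ J₆ : JetData E)

/-- `PJ = S₃ + J₃` (jet-enclosed cube window sum, chart units). -/
def PJ (y : E) : ℝ := D.S 2 y + J₃.eval y
/-- `NJ = S₆ + J₆` (jet-enclosed sixth-power window sum, chart units). -/
def NJ (y : E) : ℝ := D.S 5 y + J₆.eval y
/-- first line derivative of `PJ` -/
def dPJ (y u : E) : ℝ := D.dS 2 y u + J₃.d1 y u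
/-- first line derivative of `NJ` -/
def dNJ (y u : E) : ℝ := D.dS 5 y u + J₆.d1 y u
/-- second line derivative of `PJ` -/
def ddPJ (y u : E) : ℝ := D.ddS 2 y u + J₃.d2 y u
/-- second line derivative of `NJ` -/
def ddNJ (y u : E) : ℝ := D.ddS 5 y u + J₆.d2 y u
/-- `ψ_J = NJ / PJ²`. -/
def psiJ (y : E) : ℝ := NJ D J₆ y / PJ D J₃ y ^ 2
/-- Radial slope field of `ψ_J` (closed form; the slope rows certify signs/bounds of this expression). -/
def psiJ₁ (y u : E) : ℝ := dNJ D J₆ y u / PJ D J₃ y ^ 2 - 2 * NJ D J₆ y * dPJ D J₃ y u / PJ D J₃ y ^ 3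
/-- Radial curvature field of `ψ_J` (closed form; the convexity rows certify `m₀ ≤` this expression). -/
def psiJ₂ (y u : E) : ℝ :=
  ddNJ D J₆ y u / PJ D J₃ y ^ 2 - 4 * dNJ D J₆ y u * dPJ D J₃ y u / PJ D J₃ y ^ 3
    - 2 * NJ D J₆ y * ddPJ D J₃ y u / PJ D J₃ y ^ 3 + 6 * NJ D J₆ y * dPJ D J₃ y u ^ 2 / PJ D J₃ y ^ 4

/-- The generation-68 model is the constant-jet case: `PJ D (const x₀ D.F₃) = D.P`. [formal bookkeeping] -/
theorem PJ_const (x₀ : E) : PJ D (JetData.const x₀ D.F₃) = D.P := by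
  funext y; simp [PJ, FamilyData.P]

/-- … and `NJ D (const x₀ D.F₆) = D.N`. [formal bookkeeping] -/
theorem NJ_const (x₀ : E) : NJ D (JetData.const x₀ D.F₆) = D.N := by
  funext y; simp [NJ, FamilyData.N]

/-- `hasDerivAt_PJ_line` (docstring added by the landing lane; see the module docstring). [formal bookkeeping] -/
theorem hasDerivAt_PJ_line (y u : E) (hpos : ∀ i ∈ D.s, D.c i + D.L i y ≠ 0) :
    HasDerivAt (fun t : ℝ => PJ D J₃ (y + t • u)) (dPJ D J₃ y u) 0 := by
  unfold PJ dPJ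
  exact (D.hasDerivAt_S_line 2 y u hpos).add (J₃.hasDerivAt_eval_line y u)

/-- `hasDerivAt_NJ_line` (docstring added by the landing lane; see the module docstring). [formal bookkeeping] -/
theorem hasDerivAt_NJ_line (y u : E) (hpos : ∀ i ∈ D.s, D.c i + D.L i y ≠ 0) :
    HasDerivAt (fun t : ℝ => NJ D J₆ (y + t • u)) (dNJ D J₆ y u) 0 := by
  unfold NJ dNJ
  exact (D.hasDerivAt_S_line 5 y u hpos).add (J₆.hasDerivAt_eval_line y u)

/-- `hasDerivAt_dPJ_line` (docstring added by the landing lane; see the module docstring). [formal bookkeeping] -/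
theorem hasDerivAt_dPJ_line (y u : E) (hpos : ∀ i ∈ D.s, D.c i + D.L i y ≠ 0) :
    HasDerivAt (fun t : ℝ => dPJ D J₃ (y + t • u) u) (ddPJ D J₃ y u) 0 := by
  unfold dPJ ddPJ
  exact (D.hasDerivAt_dS_line 2 y u hpos).add (J₃.hasDerivAt_d1_line y u)

/-- `hasDerivAt_dNJ_line` (docstring added by the landing lane; see the module docstring). [formal bookkeeping] -/
theorem hasDerivAt_dNJ_line (y u : E) (hpos : ∀ i ∈ D.s, D.c i + D.L i y ≠ 0) :
    HasDerivAt (fun t : ℝ => dNJ D J₆ (y + t • u) u) (ddNJ D J₆ y u) 0 := by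
  unfold dNJ ddNJ
  exact (D.hasDerivAt_dS_line 5 y u hpos).add (J₆.hasDerivAt_d1_line y u)

/-- `hd1` of `radial_reduction` for `ψ_J`: along every line, `psiJ` has derivative `psiJ₁`. [this file] -/
theorem hasDerivAt_psiJ_line (y u : E) (hpos : ∀ i ∈ D.s, D.c i + D.L i y ≠ 0) (hP : PJ D J₃ y ≠ 0) :
    HasDerivAt (fun t : ℝ => psiJ D J₃ J₆ (y + t • u)) (psiJ₁ D J₃ J₆ y u) 0 := by
  have hN := hasDerivAt_NJ_line D J₆ y u hpos
  have hPl := hasDerivAt_PJ_line D J₃ y u hpos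
  have hP0 : (fun t : ℝ => PJ D J₃ (y + t • u)) 0 ≠ 0 := by simpa using hP
  have h := hasDerivAt_quot_sq hN hPl hP0
  unfold psiJ psiJ₁
  refine h.congr_deriv ?_
  simp only [zero_smul, add_zero]

/-- `hd2` of `radial_reduction` for `ψ_J`: along every line, `psiJ₁ (·, u)` has derivative `psiJ₂`. [this file] -/
theorem hasDerivAt_psiJ₁_line (y u : E) (hpos : ∀ i ∈ D.s, D.c i + D.L i y ≠ 0) (hP : PJ D J₃ y ≠ 0) :
    HasDerivAt (fun t : ℝ => psiJ₁ D J₃ J₆ (y + t • u) u) (psiJ₂ D J₃ J₆ y u) 0 := by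
  have hA := hasDerivAt_dNJ_line D J₆ y u hpos
  have hB := hasDerivAt_NJ_line D J₆ y u hpos
  have hC := hasDerivAt_dPJ_line D J₃ y u hpos
  have hPl := hasDerivAt_PJ_line D J₃ y u hpos
  have hP0 : (fun t : ℝ => PJ D J₃ (y + t • u)) 0 ≠ 0 := by simpa using hP
  have h := hasDerivAt_psi₁_shape hA hB hC hPl hP0
  unfold psiJ₁ psiJ₂
  refine h.congr_deriv ?_
  simp only [zero_smul, add_zero]
  ring

end Model

end Summit.AtomisticToContinuum.Crystallization.Theorems.OverbindingBudgetAffineRadialJet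

end
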